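import Summits.BirchSwinnertonDyer.BirchSwinnertonDyer.Theorems.ErratumRoadFiveNonSurjCornerTwinLowerSupplyNonSurj
import Summits.BirchSwinnertonDyer.Rank1Residual.X11b.MultiplicativeSurjectivity
import HarnessLib

/-!
# Crux `CornerAtThreeW` (item stmt-BirchSwinnertonDyer-21420; routes `ClassRecordThree` ∕ `KolyvaginRoadThree`; 19111 `CornerAtThree` aside),
# conjunct (U), the TWIN-LOWER SUPPLY on the (T4″)₃ corner: `CornerAtThreeFHTwinLowerSupply` ⟸ Friedberg–Hoffstein ∧ the X11a lower half AT
# THE CORNER'S NON-SURJECTIVE LEAF TWINS AT 3 ONLY — the `p = 3` instance of the ER5 narrowing (RULING 48 analogue at 3; cross-line helper)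
# (cell `bsd-stepL`, seat `bsd-stepL-corner-p1` g16; `--supports stmt-BirchSwinnertonDyer-21420 --as helper`; line owner lane B corner3-p2)

WHY THIS FILE. Lane B corner3-p2 g6's `…CornerAtThreeTwinLowerSupplyDefs` derives the class-wide twin-lower supply on the (T4″)₃ corner,
`CornerAtThreeFHTwinLowerSupply` (the proposed replacement of conjunct 4 «`∀ V, ClassX11a V 3 → MissingLowerBoundAt V 3`» = item 19064 read at 3,
IMC-grade, of 21420's registered `stub_upper3_inertDisplay`), from Friedberg–Hoffstein ∧ 19064@3 WHOLE
(`cornerAtThreeFHTwinLowerSupply_of_friedbergHoffstein_of_x11aLowerHalfAtThree`). This seat g16's p-GENERIC producer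
`fhTwinLowerSupplyAt_of_friedbergHoffstein_of_lowerNonSurjLeaf` (`…TwinLowerSupplyNonSurj` §3; RULING 48 for 19065) shows the X11a lower half is
needed ONLY at the corner's NON-SURJECTIVE LEAF TWINS: the twist `Cd • E^{(d_K)}` of a corner curve keeps `¬ Surj` (b2b's
`Additive.surj_iff_of_model_twist`) and `p ∣ ord_p Δ_min` (`p ∤ d_K`). THIS FILE is the `p = 3` instance on the (T4″)₃ corner (where `¬ Surj W 3`
∧ `E[3]` irreducible force `3 ∣ ord_3 Δ_min` and «no (ram) prime», `ClassX11b.dvd_and_not_ram_of_not_surj`):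
* `cornerAtThreeFHTwinLowerSupply_of_friedbergHoffstein_of_lowerLeafTwinDeepAtThree` — `CornerAtThreeFHTwinLowerSupply` ⟸ {hGZK, hmod, hnf,
  hFH} ∧ «`∀ Wd, ClassX11a Wd 3 → ¬ Surj Wd 3 → 3 ∣ ord_3 Δ_min(Wd) → ¬ X11a.ShaAnUnit Wd 3 → MissingLowerBoundAt Wd 3`» = 19064's registered
  `stub_lowerNonSurjDeep` (`Cruxes/X11aLowerHalf/Lines/birth.lean`) RESTRICTED to `p = 3` and to the leaf twins (images 3Ns ∕ 3Nn) — strictly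
  NARROWER than 19064@3 WHOLE (the IMC-grade surjective sub-leaf `stub_lowerSurjDeep` at 3 leaves 21420's cone if the line owner re-points
  conjunct 4 through this theorem; planner's ∕ lane B's call — 0 ask).
HONEST FRAMING: ONE THEOREM (no definition, no named fact, no `sorry`); CONDITIONAL on the displayed binders (Friedberg–Hoffstein, GZK, modularity,
and the OPEN ¬Surj X11a lower half at 3 — NOT covered by x11a's p ≥ 5 Hida chain; images 3Ns ∕ 3Nn); nothing is discharged; 21420 ∕ 19111 ∕
19064 stay OPEN; nothing about any curve's BSD; BSD is not advanced; T7. Credit: lane B corner3-p2 g6 (supply object and the 3-template), b2b.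
References (locators only): [cite: FriedbergHoffstein1995, Thm. B] [cite: SilvermanAEC2009, X.5 Cor. 5.4] [cite: Miller2011LMS, Def. 1.1]
[cite: GreenbergLNM1716, Conj. 1.11 (shape)].
-/

noncomputable section

open scoped Classical

open WeierstrassCurve NumberField IsDedekindDomain Literature.NumberTheory.EllipticCurves
  Rat.HeightOneSpectrum CongruenceSubgroup
  Literature.NumberTheory.EllipticCurves.ModularForms
  Literature.NumberTheory.EllipticCurves.Rank1Residual
  Literature.NumberTheory.EllipticCurves.Rank1Residual.Typed
  Literature.NumberTheory.QuadraticFields.Quadratic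
  Literature.NumberTheory.Automorphic
  Summit.BirchSwinnertonDyer.Rank1Residual
  Summit.BirchSwinnertonDyer.Rank1Residual.X11b

-- the cell's Theorems namespace repeats the summit name (Summit.<Summit>.<Problem>), as in every sibling file
set_option linter.dupNamespace false

namespace Summit.BirchSwinnertonDyer.BirchSwinnertonDyer.Theorems

/-- **`CornerAtThreeFHTwinLowerSupply` ⟸ Friedberg–Hoffstein ∧ the X11a lower half at the (T4″)₃ corner's NON-SURJECTIVE LEAF TWINS with
non-unit `#Ш_an`** (19064's registered `stub_lowerNonSurjDeep` restricted to `p = 3` and `3 ∣ ord_3 Δ_min`). On the corner `¬ Surj W 3` ∧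
`E[3]` irreducible give `3 ∣ ord_3 Δ_min(W)` and «no (ram) prime» (`ClassX11b.dvd_and_not_ram_of_not_surj`), so this seat's p-generic
`fhTwinLowerSupplyAt_of_friedbergHoffstein_of_lowerNonSurjLeaf` applies at `p = 3`; the unit case of the twin is trivial. STRICTLY NARROWER input
than lane B's `cornerAtThreeFHTwinLowerSupply_of_friedbergHoffstein_of_x11aLowerHalfAtThree` (19064@3 WHOLE). Bookkeeping; CONDITIONAL; nothing
booked; 21420 OPEN. [cite: FriedbergHoffstein1995, Thm. B] [cite: SilvermanAEC2009, X.5 Cor. 5.4] [cite: Miller2011LMS, Def. 1.1] -/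
theorem cornerAtThreeFHTwinLowerSupply_of_friedbergHoffstein_of_lowerLeafTwinDeepAtThree
    (hGZK : rank_eq_analyticRank_of_analyticRank_le_one) (hmod : hasEntireLFunction_rat)
    (hnf : exists_isNewformOf)
    (hFH : friedbergHoffstein_exists_twist_ne_zero_inertAt)
    (h₄ℓ : ∀ (Wd : WeierstrassCurve ℚ) [Wd.IsElliptic] [Wd.IsGloballyMinimal],
      ClassX11a Wd 3 → ¬ Surj Wd 3 → 3 ∣ padicValInt 3 Wd.minimalDiscriminantInt →
      ¬ X11a.ShaAnUnit Wd 3 → Typed.MissingLowerBoundAt Wd 3) :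
    CornerAtThreeFHTwinLowerSupply := by
  haveI : Fact (Nat.Prime 3) := ⟨Nat.prime_three⟩
  intro W _ _ hX hns
  obtain ⟨hv, hnram⟩ := ClassX11b.dvd_and_not_ram_of_not_surj W 3 hX hns
  exact fhTwinLowerSupplyAt_of_friedbergHoffstein_of_lowerNonSurjLeaf hGZK hmod hnf hFH W 3 hX hns hv hnram
    (fun Wd _ _ hXa hnsd hvd ↦ by
      by_cases hu : X11a.ShaAnUnit Wd 3
      · obtain ⟨q, hq, hvq⟩ := hu
        exact ⟨q, hq, by rw [hvq]; exact_mod_cast Nat.zero_le _⟩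
      · exact h₄ℓ Wd hXa hnsd hvd hu)

end Summit.BirchSwinnertonDyer.BirchSwinnertonDyer.Theorems

end
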